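import Summits.Parity.GeneralizedHardyLittlewood.Theorems.GoldbachHeathBrownDispersionHeathBrownMorozUniformOfClassLemmas
import HarnessLib

/-!
# Crux child `RangeKernelReduced` (stmt-Parity-20702) from the three class lemmas (FL, leading parts, Type II)

Helper file (`--supports stmt-Parity-20702`) for the split child
`Summit.Parity.GeneralizedHardyLittlewood.Theses.GoldbachHeathBrownDispersion.RangeKernelReduced` of the crux
`HeathBrownMorozUniform` (stmt-Parity-19915) of route `route-Parity-GoldbachHeathBrownDispersion` (Line C,
FRONTIER formalisation rung F-P1b; Heath-Brown–Moroz 2004, Theorem 2 for `x³ + 2y³`, per reduced admissible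
class, ALL-LARGE-`c` form).

The landed `heathBrownMorozUniform_of_classLemmas` (`…HeathBrownMorozUniformOfClassLemmas`, p544930) proves the
PARENT crux from the class versions of Heath-Brown's Lemma 3.5 (`h35`), Lemma 3.9 (`h39`) and Lemma 3.10 with
(3.14) up to `d·Q₁` (`h310`) by feeding `heathBrownMorozUniform_of_allLargeC` with a term whose type is — verbatim —
the split child `RangeKernelReduced`.  This file exposes that inner term:

* **`rangeKernelReduced_of_classLemmas`** : `h35 → h39 → h310 → RangeKernelReduced` (same three hypotheses,
  byte-identical with those of `heathBrownMorozUniform_of_classLemmas`; proof = its body without the final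
  finite max: class Lemma 3.7 `HeathBrownMoroz2004_lemma_3_3`, `classTypeII_terms_band`,
  `classSieveComparison_band`, `classAsymptotic_band`, frame transfer `classAsymp_allLargeC_of_band`).

So the registered skeleton `Cruxes/HeathBrownMorozUniform/Lines/parent_differencing.lean`, which supplies
`h35` (`classH35_holds`), `h39` and `h310` (`classTypeII_holds`) from its stubs, closes the child 20702 by the same
one application with which it closes the parent.  **Nothing here proves the three class lemmas, and nothing here
bears on Goldbach** (formalisation of a 2004 theorem; the route's target is an almost-all statement with a thin
cubic prime summand).

References: [cite: HeathBrownMoroz2004, Theorem 2 and §5]; [cite: HeathBrownActa2001, Theorem 1, Lemmas 3.5, 3.9, 3.10].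
-/

noncomputable section

open Polynomial NumberField Finset Filter Topology Asymptotics

namespace Summit.Parity.GeneralizedHardyLittlewood.Theorems.GoldbachHeathBrownDispersionHeathBrownMorozUniform

open Literature.NumberTheory.Sieve.CubicSieve Literature.NumberTheory.Sieve.CubicPrimes
open Literature.NumberTheory.LFunctions.CubeRootTwoField

/-- **The split child `RangeKernelReduced` from the three class lemmas** (`h35` = class Lemma 3.5 / HBM04
Lemma 3.1, `h39` = class Lemma 3.9 / HBM04 Lemma 4.1, `h310` = class Lemma 3.10 with (3.14) up to `d·Q₁` / HBM04
Prop. 4.2 (ii)): for every reduced admissible class `(a, b) mod d` there is `c₁ > 0` such that for every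
`c ≥ c₁`, `residueClassPrimeCount X (log X)^{-c} d a b = w(d)·mainTerm c σ₀ X·(1 + o(1))` with `σ₀` the limit of
the singular product.  Proof: class Lemma 3.7 (`HeathBrownMoroz2004_lemma_3_3`, the parent's bound restricted to
the subfamily), the η-band bookkeeping `classTypeII_terms_band` → `classSieveComparison_band` →
`classAsymptotic_band`, and the frame transfer `classAsymp_allLargeC_of_band` — the body of
`heathBrownMorozUniform_of_classLemmas` before its finite max. [cite: HeathBrownMoroz2004, Theorem 2]
[cite: HeathBrownActa2001, Theorem 1] -/
theorem rangeKernelReduced_of_classLemmas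
    (h35 : ∀ d a b : ℕ, 0 < d → a < d → b < d → Nat.Coprime (a ^ 3 + 2 * b ^ 3) d →
      ∀ σ₀ : ℝ, Tendsto singularProductPartial atTop (𝓝 σ₀) → ∀ ϖ : ℝ, 0 < ϖ → ϖ < 1 / 5 →
        ∃ C X₀ : ℝ, ∀ X η : ℝ, X₀ ≤ X → Real.exp (-Real.log X ^ (1 / 3 : ℝ)) ≤ η → η ≤ 1 →
          ∑ n ∈ range (chainBound (hbTau ϖ X) + 1),
              |(Tpiece (classPairs X η d a b) pairIdeal X (hbTau ϖ X) n : ℝ) -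
                  classKappa σ₀ X η d * Tpiece (normWindow X η) (fun J => J) X (hbTau ϖ X) n| ≤
            C * hbTau ϖ X * η ^ 2 * X ^ 2 / Real.log X)
    (h39 : ∀ d a b : ℕ, 0 < d → a < d → b < d → Nat.Coprime (a ^ 3 + 2 * b ^ 3) d →
      ∀ σ₀ : ℝ, Tendsto singularProductPartial atTop (𝓝 σ₀) → ∀ ϖ : ℝ, 0 < ϖ → ϖ < 1 / 5 →
        ∃ c C X₀ : ℝ, ∀ X η : ℝ, X₀ ≤ X → Real.exp (-Real.log X ^ (1 / 3 : ℝ)) ≤ η → η ≤ 1 →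
          ∀ (k : ℕ) (m : Fin k → ℕ), CoreAdmissible (hbTau ϖ X) m →
            ∀ cR : Ideal (𝓞 K) → ℝ, CSupport X (hbTau ϖ X) cR →
              |bilin (classPairs X η d a b) pairIdeal cR (eWeight X (hbTau ϖ X) m) -
                  classKappa σ₀ X η d *
                    bilin (normWindow X η) (fun J => J) cR (dWeight X (hbTau ϖ X) m)| ≤
                C * (∏ i, (m i : ℝ))⁻¹ * η ^ (5 / 2 : ℝ) * X ^ 2 * Real.log X ^ c)
    (h310 : ∀ d a b : ℕ, 0 < d → a < d → b < d → Nat.Coprime (a ^ 3 + 2 * b ^ 3) d →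
      ∀ ϖ : ℝ, 0 < ϖ → ϖ < 1 / 5 →
        ∃ c c₃ c₄ : ℝ, 0 < c₃ ∧ 0 < c₄ ∧ ∀ C₁ c₁ c₅ c₆ : ℝ, 0 < c₁ → 0 < c₅ → 0 < c₆ →
          ∃ C X₀ : ℝ, ∀ X η Q₁ : ℝ, X₀ ≤ X → Real.exp (-Real.log X ^ (1 / 3 : ℝ)) ≤ η → η ≤ 1 →
            1 ≤ Q₁ → (d : ℝ) * Q₁ ≤ Real.exp (Real.log X ^ (1 / 3 : ℝ)) →
              (∀ (k' : ℕ) (m' : Fin k' → ℕ), CoreAdmissible (hbTau ϖ X) m' →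
                Hyp314 X (hbTau ϖ X) m' ((d : ℝ) * Q₁) C₁ c₁ c₃ c₄) →
                ∀ (k : ℕ) (m : Fin k → ℕ), CoreAdmissible (hbTau ϖ X) m →
                  ∀ cR : Ideal (𝓞 K) → ℝ, CSupport X (hbTau ϖ X) cR →
                    ∀ V : ℝ, c₅ * X ^ (1 + hbTau ϖ X) ≤ V → V ≤ c₆ * X ^ (3 / 2 - hbTau ϖ X) →
                      |bilin (classPairs X η d a b) pairIdeal cR
                          (fun S => if V < (Ideal.absNorm S : ℝ) ∧ (Ideal.absNorm S : ℝ) ≤ 2 * V then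
                            fWeight X (hbTau ϖ X) m S else 0)| ≤
                        C * X ^ 2 * Q₁ ^ (-(1 / 160 : ℝ)) * Real.log X ^ c) :
    Summit.Parity.GeneralizedHardyLittlewood.Theses.GoldbachHeathBrownDispersion.RangeKernelReduced := by
  unfold Summit.Parity.GeneralizedHardyLittlewood.Theses.GoldbachHeathBrownDispersion.RangeKernelReduced
  intro d a b hd ha hb hadm
  have hd1 : 1 ≤ d := hd
  have h37A : ∀ ϖ : ℝ, 0 < ϖ → ϖ < 1 / 5 →
      ∃ C X₀ : ℝ, ∀ X η : ℝ, X₀ ≤ X → Real.exp (-Real.log X ^ (1 / 3 : ℝ)) ≤ η → η ≤ 1 →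
        (∑ n ∈ Icc 3 (chainBound (hbTau ϖ X)),
            |(Upiece (classPairs X η d a b) pairIdeal X (hbTau ϖ X) n : ℝ) -
              Uhat X (hbTau ϖ X) (classPairs X η d a b) pairIdeal n| ≤
          C * (hbXi (hbTau ϖ X) / hbTau ϖ X ^ 4) * (η ^ 2 * X ^ 2 / Real.log X)) ∧
        (|(U1piece (classPairs X η d a b) pairIdeal X (hbTau ϖ X) 1 : ℝ) -
            Uhat X (hbTau ϖ X) (classPairs X η d a b) pairIdeal 1| ≤
          C * (hbXi (hbTau ϖ X) / hbTau ϖ X ^ 4) * (η ^ 2 * X ^ 2 / Real.log X)) ∧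
        (|(U1piece (classPairs X η d a b) pairIdeal X (hbTau ϖ X) 2 : ℝ) -
            Uhat X (hbTau ϖ X) (classPairs X η d a b) pairIdeal 2| ≤
          C * (hbXi (hbTau ϖ X) / hbTau ϖ X ^ 4) * (η ^ 2 * X ^ 2 / Real.log X)) ∧
        (|(S₄ (classPairs X η d a b) pairIdeal X (hbTau ϖ X) : ℝ) -
            S4hat X (hbTau ϖ X) (classPairs X η d a b) pairIdeal| ≤
          C * (hbXi (hbTau ϖ X) / hbTau ϖ X ^ 4) * (η ^ 2 * X ^ 2 / Real.log X)) ∧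
        (|(U2one (classPairs X η d a b) pairIdeal X (hbTau ϖ X) : ℝ) -
            U2hat X (hbTau ϖ X) (classPairs X η d a b) pairIdeal| ≤
          C * (hbXi (hbTau ϖ X) / hbTau ϖ X ^ 4) * (η ^ 2 * X ^ 2 / Real.log X)) := by
    intro ϖ h0 h1
    obtain ⟨C, X₀, h⟩ := HeathBrownMoroz2004_lemma_3_3 ϖ h0 h1
    exact ⟨C, X₀, fun X η hX hη hη1 => h X η hX hη hη1 _ (classPairs_subset_boxPairs X η d a b)⟩
  have hII := classTypeII_terms_band d a b hd1 h37A (h39 d a b hd ha hb hadm) (h310 d a b hd ha hb hadm)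
  have hcmp := classSieveComparison_band d a b hd1 (h35 d a b hd ha hb hadm) hII
  exact classAsymp_allLargeC_of_band hd1 (classAsymptotic_band d a b hd1 hcmp)

end Summit.Parity.GeneralizedHardyLittlewood.Theorems.GoldbachHeathBrownDispersionHeathBrownMorozUniform

end
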